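import Literature.NumberTheory.Sieve.WelshCubicRootsBounds
import HarnessLib

/-!
# Welsh 2018, Theorem 1 with the corrected second and third points

`Welsh2018_thm1` (`Literature/NumberTheory/Sieve/WelshCubicRoots.lean`, proved in
`WelshCubicRootsProofs`) transcribes the three approximating points of Welsh's eq. (24)/(37)
(arXiv:1809.05211) verbatim. The printed second and third points carry a typo: the paper derives
the points (§4, (22)–(26)) as the pairwise intersections of the lines `bX + cY = u`, `aX + bY = v`,
`2cX + aY = w`, which are `((bu-cv)/(b²-ac), (bv-au)/(b²-ac))`,
`((cw-au)/(2c²-ab), (2cu-bw)/(2c²-ab))`, `((av-bw)/(a²-2bc), (aw-2cv)/(a²-2bc))` — the numerators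
being minus the second and third entries of the columns of `γ⁻¹` in (18)/(53), as used in the proof
of Theorem 2 — whereas (24)/(37) print `((cv-au)/…, (2cu-bv)/…)` and `((au-bv)/…, (av-2cu)/…)`
(`v` for `w`, resp. `(u,v)` for `(v,w)`). This file records the statement the paper actually proves
and uses, `Welsh2018_thm1_corrected`, and proves it (`Welsh2018_thm1_corrected_holds`, constant
`C = 120`, via `Welsh2018.thm1_corrected_inner`); for these points the exact errors are
`(-B,-A)/(mC)`, `(-A,-2C)/(mB)`, `(-2C,-2B)/(mA)` for EVERY Bezout triple `(u,v,w)` (eq. (26)),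
whereas the printed points need the particular triple of `Welsh2018.shift_lemma`.

## References
* [Welsh2018CubicCongruenceSpacing] M. C. Welsh, arXiv:1809.05211 (2018), Thm 1 (p. 9), Lemma 2
  (p. 7), §4 (22)–(26) (p. 8), §5 (p. 9), (53) (p. 11).
-/

noncomputable section

namespace Literature.NumberTheory.Sieve

open Welsh2018

/-- **Welsh 2018, Theorem 1 with Lemma 2 and the bounds of §5 — corrected second and third
points.** Identical to `Welsh2018_thm1` ((i) `m = a³+2b³+4c³-6abc`, (ii) the Bezout relation (16),
(iii) Lemma 2's congruence (19) for `ν`, (iv) `|a|,|b|,|c| ≤ Cm^{1/3}`, (v)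
`m^{2/3}/C ≤ |b²-ac|, |2c²-ab|, |a²-2bc| ≤ Cm^{2/3}`, (vi) three points within `C/m` of
`(ν/m, ν²/m)` on `ℝ²/ℤ²`) except that the second and third points are the actual pairwise
intersections of the lines `bX+cY=u`, `aX+bY=v`, `2cX+aY=w` of §4:
`((cw-au)/(2c²-ab), (2cu-bw)/(2c²-ab))` and `((av-bw)/(a²-2bc), (aw-2cv)/(a²-2bc))`
(the printed eq. (24)/(37) have `v` in place of `w`, resp. `(u,v)` in place of `(v,w)`; the
paper's derivation (25)–(26) and `γ⁻¹` in (18)/(53) give these). Proved below.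
[cite: Welsh2018CubicCongruenceSpacing, Thm 1 (p. 9) with Lemma 2 (p. 7), §4 (22)–(26) and §5] -/
def Welsh2018_thm1_corrected : Prop :=
  ∃ C : ℝ, 0 < C ∧ ∀ (m : ℕ) (ν : ℤ), 1 ≤ m → (m : ℤ) ∣ ν ^ 3 - 2 →
    ∃ a b c u v w : ℤ,
      (m : ℤ) = a ^ 3 + 2 * b ^ 3 + 4 * c ^ 3 - 6 * a * b * c ∧
      u * (a ^ 2 - 2 * b * c) + v * (2 * c ^ 2 - a * b) + w * (b ^ 2 - a * c) = 1 ∧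
      (m : ℤ) ∣ ν + (a * (b * w - a * v) + 2 * c * (a * u - c * w) + 2 * b * (c * v - b * u)) ∧
      (|(a : ℝ)| ≤ C * (m : ℝ) ^ ((1 : ℝ) / 3) ∧ |(b : ℝ)| ≤ C * (m : ℝ) ^ ((1 : ℝ) / 3) ∧
        |(c : ℝ)| ≤ C * (m : ℝ) ^ ((1 : ℝ) / 3)) ∧
      ((m : ℝ) ^ ((2 : ℝ) / 3) / C ≤ |((b ^ 2 - a * c : ℤ) : ℝ)| ∧
        |((b ^ 2 - a * c : ℤ) : ℝ)| ≤ C * (m : ℝ) ^ ((2 : ℝ) / 3) ∧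
        (m : ℝ) ^ ((2 : ℝ) / 3) / C ≤ |((2 * c ^ 2 - a * b : ℤ) : ℝ)| ∧
        |((2 * c ^ 2 - a * b : ℤ) : ℝ)| ≤ C * (m : ℝ) ^ ((2 : ℝ) / 3) ∧
        (m : ℝ) ^ ((2 : ℝ) / 3) / C ≤ |((a ^ 2 - 2 * b * c : ℤ) : ℝ)| ∧
        |((a ^ 2 - 2 * b * c : ℤ) : ℝ)| ≤ C * (m : ℝ) ^ ((2 : ℝ) / 3)) ∧
      TorusClose (C / m) (((b * u - c * v : ℤ) : ℝ) / ((b ^ 2 - a * c : ℤ) : ℝ))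
        (((b * v - a * u : ℤ) : ℝ) / ((b ^ 2 - a * c : ℤ) : ℝ)) ((ν : ℝ) / m) ((ν : ℝ) ^ 2 / m) ∧
      TorusClose (C / m) (((c * w - a * u : ℤ) : ℝ) / ((2 * c ^ 2 - a * b : ℤ) : ℝ))
        (((2 * c * u - b * w : ℤ) : ℝ) / ((2 * c ^ 2 - a * b : ℤ) : ℝ)) ((ν : ℝ) / m)
        ((ν : ℝ) ^ 2 / m) ∧
      TorusClose (C / m) (((a * v - b * w : ℤ) : ℝ) / ((a ^ 2 - 2 * b * c : ℤ) : ℝ))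
        (((a * w - 2 * c * v : ℤ) : ℝ) / ((a ^ 2 - 2 * b * c : ℤ) : ℝ)) ((ν : ℝ) / m)
        ((ν : ℝ) ^ 2 / m)

/-- **Discharge of `Welsh2018_thm1_corrected`** with the absolute constant `C = 120`
(`Welsh2018.thm1_corrected_inner`). [cite: Welsh2018CubicCongruenceSpacing, Thm 1 (p. 9)] -/
theorem Welsh2018_thm1_corrected_holds : Welsh2018_thm1_corrected :=
  ⟨120, by norm_num, fun m ν hm hν => thm1_corrected_inner m ν hm hν⟩

end Literature.NumberTheory.Sieve
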